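import Summits.QuantumFields.YangMills.Theorems.BalabanUVNodesN09CentralWindowJacobianGraphContinuous
import Literature.MathematicalPhysics.QuantumFieldTheory.Balaban1983to89.HaarDist1LevelHypersurface
import Literature.MathematicalPhysics.QuantumFieldTheory.Balaban1983to89.B12ContinuousTransportInvarianceOn
import HarnessLib

/-!
# LINE g18-2 «wreg_chart» (20520 organ WREG) — EDGE engine, part 1: the abstract «null for a.e. parameter ⇒ null for EVERY parameter»
# transitivity lemma, and the one-step Haar-null transport of the (0.4) average on central windows

Cell `ym3-torus`, width seat `ym3-torus-px17` g6 (helper of `stmt-QuantumFields-20520` = `UnitScaleTilt.FluctuationComparisonRegPrIntL`,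
`--supports`, count-neutral).  First file of the road to the chart-free stub `stub_edgeFlat : EdgeFlat` of the ideator seat ym-r3-idea-1 g18's
`Cruxes/FluctuationComparisonRegPrIntL/Lines/wreg_chart.lean` (v14 :1953): «for a fixed group element `v` and bond `c`, the environments `z` for
which `v` lies on the EDGE of the image window form a `fieldMeasure`-null set».

THE ROAD (no analyticity of the inverse chart is used).  (i) For EVERY environment `z` the edge image `E_z ⊆ SU(2)` is Haar-null (forward law of the
chain + Haar-nullity of `dist1`-spheres), so the measurable set `M = {(z, v) | v ∈ E_z}` is `fieldMeasure ⊗ Haar`-null and its `v`-sections are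
`fieldMeasure`-null for Haar-a.e. `v` (Fubini); (ii) the chain is gauge-COVARIANT and the windows are gauge-INVARIANT, a gauge transformation
concentrated at the initial point of `c` multiplies the chain value on the left and preserves `fieldMeasure`, and left multiplication is transitive
on the group — so `v ↦ fieldMeasure{z | v ∈ E_z}` is constant, hence `0` for EVERY `v`.  §1 below is step (ii) in the abstract (pure measure theory);
§2 is the one-step input of (i): the W-coordinates of a central `α`-window are continuous ∕ jointly measurable and its edge set is measurable and
Haar-null; on the window the one-variable (0.4) average maps Haar-null sets to Haar-null sets and pulls Haar-null sets back to Haar-null sets (N09's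
forward law with a positive continuous Jacobian, pub-ymgap dag-n09-w4∕w6).

HONEST FRAMING.  Measure-theoretic bookkeeping over landed N09 calculus; nothing of Bałaban's is asserted; EDGE itself is NOT proved in this file
(parts 2–3 thread §2 through the chain and assemble); WREG, S2β, `FluctuationComparisonRegPrIntL` (20520) and every other crux are NOT proved;
rung R3 = YM₃ on T³ — NOT d = 4, NOT infinite volume, NOT a mass gap, NOT Clay.
-/

noncomputable section

open MeasureTheory Set Function Filter Topology
open scoped ENNReal NNReal
open Literature.MathematicalPhysics.QuantumFieldTheory.Balaban1983to89
open Literature.MathematicalPhysics.QuantumFieldTheory.Balaban1983to89.Node00 (SU)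
open Literature.MathematicalPhysics.QuantumFieldTheory.Balaban1983to89.ExpMeanLog (expMeanLogSU deltaSU)
open Literature.MathematicalPhysics.QuantumFieldTheory.Balaban1983to89.BlockAveraging (Idx avgFun)
open Literature.MathematicalPhysics.QuantumFieldTheory.Balaban1983to89.BlockAveragingHaarAC (centralBond pre post openHol IsCentral)
open Literature.MathematicalPhysics.QuantumFieldTheory.Balaban1983to89.BlockAveragingEMLHaarAC (fibreFamily offCard
  fibreFamily_of_isCentral fibreFamily_of_not_isCentral)
open Summit.QuantumFields.YangMills.BalabanUVNodes.N09CentralWindowJacobianGraphContinuous (exists_jacobian_forwardLaws_continuousOn_graph)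

namespace Summit.QuantumFields.YangMills.Theorems.FluctuationComparisonRegPrIntLWregChartEdgeEngine

/-! ## §1  The abstract engine: a product-null measurable set whose sections are permuted transitively by measure-preserving maps has ALL
sections null -/

/-- ★★ **NULL FOR A.E. PARAMETER ⇒ NULL FOR EVERY PARAMETER, BY TRANSITIVITY.**  Let `M ⊆ Z × G` be measurable with `ν`-null `z`-sections
for `μ`-a.e. `z` (`μ`, `ν` s-finite, `ν ≠ 0`).  If a family of `μ`-preserving maps `τ a : Z → Z` moves the `v`-sections of `M` along maps
`σ a : G → G` — `(τ a z, v) ∈ M ↔ (z, σ a v) ∈ M` — and the `σ a` act transitively, then EVERY `v`-section `{z | (z, v) ∈ M}` is `μ`-null.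
(Fubini both ways: `∫ μ(M^v) dν(v) = ∫ ν(M_z) dμ(z) = 0`, so some `v₀`-section is null; transport it to any `v` by the `τ`.) [folklore] -/
theorem measure_section_eq_zero_of_ae_null_of_transitive {Z G A : Type*} [MeasurableSpace Z] [MeasurableSpace G]
    (μ : Measure Z) (ν : Measure G) [SFinite μ] [SFinite ν] [NeZero ν]
    {M : Set (Z × G)} (hM : MeasurableSet M) (hnull : ∀ᵐ z ∂μ, ν (Prod.mk z ⁻¹' M) = 0)
    (τ : A → Z → Z) (σ : A → G → G) (hτ : ∀ a, MeasurePreserving (τ a) μ μ)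
    (hcov : ∀ a z v, (τ a z, v) ∈ M ↔ (z, σ a v) ∈ M) (htrans : ∀ v v' : G, ∃ a, σ a v = v') (v : G) :
    μ {z | (z, v) ∈ M} = 0 := by
  -- Fubini: the product measure of `M` vanishes, hence so does `∫ μ(M^v) dν`
  have hprod : (μ.prod ν) M = 0 := (Measure.measure_prod_null hM).2 hnull
  have hsymm : ∫⁻ w, μ ((fun z => (z, w)) ⁻¹' M) ∂ν = 0 := by rw [← Measure.prod_apply_symm hM]; exact hprod
  have hae : ∀ᵐ w ∂ν, μ ((fun z => (z, w)) ⁻¹' M) = 0 :=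
    (lintegral_eq_zero_iff (measurable_measure_prodMk_right hM)).1 hsymm
  obtain ⟨v₀, hv₀⟩ := hae.exists
  obtain ⟨a, ha⟩ := htrans v v₀
  have hsec : MeasurableSet {z | (z, v) ∈ M} := hM.preimage measurable_prodMk_right
  have hpre : τ a ⁻¹' {z | (z, v) ∈ M} = {z | (z, v₀) ∈ M} := by
    ext z
    simp only [mem_preimage, mem_setOf_eq, hcov a z v, ha]
  rw [← (hτ a).measure_preimage hsec.nullMeasurableSet, hpre]
  exact hv₀

/-! ## §2  One step of the (0.4) average on a central `α`-window: Haar-null sets go to Haar-null sets, both ways; the edge set is Haar-null -/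

section OneStep

variable {P : Params} {j : ℕ} {N : ℕ} [NeZero N]

/-- The W-coordinates `h ↦ fibreFamily W c (pre W c·h·post W c) i` are continuous in the pivot value. [cite: Balaban1987RG1, (0.4) p.253 (bookkeeping)] -/
theorem continuous_coord (W : GaugeField P j (SU N)) (c : PBond P (j + 1)) (i : Idx P) :
    Continuous fun h : SU N => dist1 (fibreFamily W c (pre W c * h * post W c) i) := by
  refine B12ContinuousTransportInvarianceOn.continuous_dist1_SU.comp ?_
  have hW : Continuous fun h : SU N => pre W c * h * post W c := (continuous_const.mul continuous_id).mul continuous_const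
  by_cases hi : IsCentral c i
  · simp only [fibreFamily, if_pos hi]
    exact continuous_const
  · simp only [fibreFamily, if_neg hi]
    exact continuous_const.mul hW.inv

/-- The edge set `{h | ∃ i, dist1 (coordinate i) = α}` of a central window is measurable (finite union of closed level sets). [folklore] -/
theorem measurableSet_edgeSet (W : GaugeField P j (SU N)) (c : PBond P (j + 1)) (α : ℝ) :
    MeasurableSet {h : SU N | ∃ i : Idx P, dist1 (fibreFamily W c (pre W c * h * post W c) i) = α} := by
  have hset : {h : SU N | ∃ i : Idx P, dist1 (fibreFamily W c (pre W c * h * post W c) i) = α} =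
      ⋃ i : Idx P, {h : SU N | dist1 (fibreFamily W c (pre W c * h * post W c) i) = α} := by
    ext h; simp only [mem_setOf_eq, mem_iUnion]
  rw [hset]
  exact MeasurableSet.iUnion fun i => (isClosed_eq (continuous_coord W c i) continuous_const).measurableSet

/-- The W-coordinates are jointly measurable in `(environment, pivot value)`. [folklore] -/
theorem measurable_coord_prod (c : PBond P (j + 1)) (i : Idx P) :
    Measurable fun p : GaugeField P j (SU N) × SU N => dist1 (fibreFamily p.1 c (pre p.1 c * p.2 * post p.1 c) i) := by
  refine B12ContinuousTransportInvarianceOn.continuous_dist1_SU.measurable.comp ?_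
  have hpre : Measurable fun U : GaugeField P j (SU N) => pre U c := T4Continuum.measurable_holAt _
  have hpost : Measurable fun U : GaugeField P j (SU N) => post U c := T4Continuum.measurable_holAt _
  have hW : Measurable fun p : GaugeField P j (SU N) × SU N => pre p.1 c * p.2 * post p.1 c :=
    ((hpre.comp measurable_fst).mul measurable_snd).mul (hpost.comp measurable_fst)
  by_cases hi : IsCentral c i
  · simp only [fibreFamily, if_pos hi]
    exact measurable_const
  · simp only [fibreFamily, if_neg hi]
    have hhol : Measurable fun U : GaugeField P j (SU N) => openHol U c i := T4Continuum.measurable_holAt _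
    exact (hhol.comp measurable_fst).mul hW.inv

/-- **THE EDGE SET OF A CENTRAL WINDOW IS HAAR-NULL**: for `α ≠ 0` and every environment `U`, `Haar{g | ∃ i, dist1(fibreFamily U c (pre·g·post) i) = α} = 0`
— at a central index the coordinate is `1` (`dist1 1 = 0 ≠ α`), at an off-central one it is `V_i·(pre·g·post)⁻¹`, whose `dist1`-level set is a
two-sided translate of the Haar-null `dist1`-sphere (`HaarDist1LevelHypersurface`, bi-invariance of Haar). [cite: BrockerTomDieck1985, IV (2.11) (proof)] -/
theorem haar_edgeSet_eq_zero (U : GaugeField P j (SU N)) (c : PBond P (j + 1)) {α : ℝ} (hα : α ≠ 0) :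
    (HaarData.haar : Measure (SU N)) {g : SU N | ∃ i : Idx P, dist1 (fibreFamily U c (pre U c * g * post U c) i) = α} = 0 := by
  classical
  have hsphere : (HaarData.haar : Measure (SU N)) {h : SU N | dist1 h = α} = 0 := by
    have h := HaarDist1LevelHypersurface.haar_setOf_dist1_mem_eq_zero_specialUnitaryGroup (n := Fin N) (R := {α})
      (Set.countable_singleton α) (by simpa using hα.symm)
    simpa only [Set.mem_singleton_iff] using h
  have hset : {g : SU N | ∃ i : Idx P, dist1 (fibreFamily U c (pre U c * g * post U c) i) = α} =
      ⋃ i : Idx P, {g : SU N | dist1 (fibreFamily U c (pre U c * g * post U c) i) = α} := by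
    ext g; simp only [mem_setOf_eq, mem_iUnion]
  rw [hset]
  refine (measure_iUnion_null_iff).2 fun i => ?_
  by_cases hc : IsCentral c i
  · have hempty : {g : SU N | dist1 (fibreFamily U c (pre U c * g * post U c) i) = α} = ∅ := by
      ext g
      simp only [mem_setOf_eq, mem_empty_iff_false, iff_false, fibreFamily_of_isCentral U c _ i hc, GaugeGroup.dist1_one]
      exact fun h => hα h.symm
    rw [hempty, measure_empty]
  · -- `dist1 (V·(pre g post)⁻¹) = dist1 ((pre g post)·V⁻¹) = dist1 (g · (post V⁻¹ pre))` (inverse, then conjugation by `pre`)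
    set k : SU N := post U c * (openHol U c i)⁻¹ * pre U c with hk
    have hlevel : {g : SU N | dist1 (fibreFamily U c (pre U c * g * post U c) i) = α} = (fun g : SU N => g * k) ⁻¹' {h : SU N | dist1 h = α} := by
      ext g
      simp only [mem_setOf_eq, mem_preimage, fibreFamily_of_not_isCentral U c _ i hc]
      have h1 : dist1 (openHol U c i * (pre U c * g * post U c)⁻¹) = dist1 (pre U c * g * post U c * (openHol U c i)⁻¹) := by
        rw [← GaugeGroup.dist1_inv, mul_inv_rev, inv_inv]
      have h2 : pre U c * g * post U c * (openHol U c i)⁻¹ = pre U c * (g * k) * (pre U c)⁻¹ := by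
        rw [hk]; group
      rw [h1, h2, GaugeGroup.dist1_conj]
    rw [hlevel, ← Measure.map_apply (measurable_mul_const k) ((isClosed_eq (B12ContinuousTransportInvarianceOn.continuous_dist1_SU (N := N)) continuous_const).measurableSet),
      HaarData.map_mul_right]
    exact hsphere

/-- **PUSH: on a central `α`-window the one-variable (0.4) average maps Haar-null measurable sets to Haar-null sets** (forward law with density +
injectivity on the window: `Haar(f '' A) = ∫_A jac = 0`). Regime: `j + 1 ≤ m + K`, `0 ≤ α ≤ 1∕24`, `64·α ≤ δ_N`, `157·α < L^{−(d−1)}`, gap numerics.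
[cite: Balaban1987RG1, (0.4) p.253 and (2.10) p.267] -/
theorem haar_image_eq_zero_of_subset_window (hj : j + 1 ≤ P.m + P.K) {α : ℝ} (hα0 : 0 ≤ α) (hα24 : α ≤ 1 / 24)
    (hα64 : 64 * α ≤ deltaSU (Fin N)) (hαL : 157 * α < ((P.L : ℝ) ^ (P.d - 1))⁻¹)
    (hgap : ∀ c : PBond P (j + 1), (offCard c : ℝ) / (Fintype.card (Idx P) : ℝ) + 150 * α < 1)
    (U : GaugeField P j (SU N)) (c : PBond P (j + 1)) {A : Set (SU N)} (hA : MeasurableSet A)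
    (hAΩ : A ⊆ {g : SU N | ∀ i : Idx P, dist1 (fibreFamily U c (pre U c * g * post U c) i) ≤ α})
    (hA0 : (HaarData.haar : Measure (SU N)) A = 0) :
    (HaarData.haar : Measure (SU N)) ((fun g : SU N => avgFun (expMeanLogSU (n := Fin N)) (update U (centralBond c) g) c) '' A) = 0 := by
  classical
  obtain ⟨jac, -, -, hfwd, -, -⟩ := exists_jacobian_forwardLaws_continuousOn_graph (N := N) (P := P) hj hα0 hα24 hα64 hαL hgap
  set Ω : Set (SU N) := {g : SU N | ∀ i : Idx P, dist1 (fibreFamily U c (pre U c * g * post U c) i) ≤ α} with hΩ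
  set f : SU N → SU N := fun g : SU N => avgFun (expMeanLogSU (n := Fin N)) (update U (centralBond c) g) c with hf
  have hlaw := hfwd c U
  have hAv : Measurable (avgFun (expMeanLogSU (n := Fin N)) : GaugeField P j (SU N) → GaugeField P (j + 1) (SU N)) :=
    BlockAveraging.measurable_avgFun _ ExpMeanLog.measurable_expMeanLogSU_E
  have hfm : Measurable f := (measurable_pi_apply c).comp (hAv.comp (measurable_update U))
  have hinj : InjOn f Ω :=
    Summit.QuantumFields.YangMills.BalabanUVNodes.N09CentralWindowAtRecord.avgFun_update_centralBond_injOn_centralWindow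
      (N := N) hj U c hα0 hα24 (by nlinarith [ExpMeanLog.deltaSU_pos (n := Fin N)]) (hgap c)
  have hfA : MeasurableSet (f '' A) := hA.image_of_measurable_injOn hfm (hinj.mono hAΩ)
  have hpre : f ⁻¹' (f '' A) ∩ Ω = A := by
    ext g
    refine ⟨fun ⟨⟨g', hg'A, hgg'⟩, hgΩ⟩ => ?_, fun hg => ⟨subset_preimage_image f A hg, hAΩ hg⟩⟩
    rwa [← hinj (hAΩ hg'A) hgΩ hgg']
  calc (HaarData.haar : Measure (SU N)) (f '' A)
      = ((HaarData.haar : Measure (SU N)).restrict (f '' Ω)) (f '' A) :=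
        (Measure.restrict_eq_self _ (image_mono hAΩ)).symm
    _ = ((((HaarData.haar : Measure (SU N)).restrict Ω).withDensity fun g => (jac c U g : ℝ≥0∞)).map f) (f '' A) := by rw [hlaw]
    _ = (((HaarData.haar : Measure (SU N)).restrict Ω).withDensity fun g => (jac c U g : ℝ≥0∞)) (f ⁻¹' (f '' A)) :=
        Measure.map_apply hfm hfA
    _ = ∫⁻ g in f ⁻¹' (f '' A) ∩ Ω, (jac c U g : ℝ≥0∞) ∂(HaarData.haar : Measure (SU N)) := by
        rw [withDensity_apply _ (hfA.preimage hfm), Measure.restrict_restrict (hfA.preimage hfm)]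
    _ = ∫⁻ g in A, (jac c U g : ℝ≥0∞) ∂(HaarData.haar : Measure (SU N)) := by rw [hpre]
    _ = 0 := by rw [Measure.restrict_eq_zero.2 hA0, lintegral_zero_measure]

/-- **PULL: on a central `α`-window the one-variable (0.4) average pulls Haar-null measurable sets back to Haar-null sets** (`Haar⌊Ω ≪ (Haar⌊Ω)·jac`
since `jac ≠ 0` on the window, and `((Haar⌊Ω)·jac)(f⁻¹ B) ≤ (f_*…)(B) = Haar⌊(f '' Ω) (B) ≤ Haar B = 0`). Same regime.
[cite: Balaban1987RG1, (0.4) p.253 and (2.10) p.267] -/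
theorem haar_window_inter_preimage_eq_zero (hj : j + 1 ≤ P.m + P.K) {α : ℝ} (hα0 : 0 ≤ α) (hα24 : α ≤ 1 / 24)
    (hα64 : 64 * α ≤ deltaSU (Fin N)) (hαL : 157 * α < ((P.L : ℝ) ^ (P.d - 1))⁻¹)
    (hgap : ∀ c : PBond P (j + 1), (offCard c : ℝ) / (Fintype.card (Idx P) : ℝ) + 150 * α < 1)
    (U : GaugeField P j (SU N)) (c : PBond P (j + 1)) {B : Set (SU N)}
    (hB0 : (HaarData.haar : Measure (SU N)) B = 0) :
    (HaarData.haar : Measure (SU N)) ({g : SU N | ∀ i : Idx P, dist1 (fibreFamily U c (pre U c * g * post U c) i) ≤ α} ∩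
      (fun g : SU N => avgFun (expMeanLogSU (n := Fin N)) (update U (centralBond c) g) c) ⁻¹' B) = 0 := by
  classical
  obtain ⟨jac, hjacm, hjac0, hfwd, -, -⟩ := exists_jacobian_forwardLaws_continuousOn_graph (N := N) (P := P) hj hα0 hα24 hα64 hαL hgap
  set Ω : Set (SU N) := {g : SU N | ∀ i : Idx P, dist1 (fibreFamily U c (pre U c * g * post U c) i) ≤ α} with hΩ
  set f : SU N → SU N := fun g : SU N => avgFun (expMeanLogSU (n := Fin N)) (update U (centralBond c) g) c with hf
  have hlaw := hfwd c U
  have hAv : Measurable (avgFun (expMeanLogSU (n := Fin N)) : GaugeField P j (SU N) → GaugeField P (j + 1) (SU N)) :=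
    BlockAveraging.measurable_avgFun _ ExpMeanLog.measurable_expMeanLogSU_E
  have hfm : Measurable f := (measurable_pi_apply c).comp (hAv.comp (measurable_update U))
  have hΩm : MeasurableSet Ω :=
    ((Summit.QuantumFields.YangMills.BalabanUVNodes.N09CentralWindowForwardLaw.isClosed_centralWindowW U c α).preimage
      ((continuous_const.mul continuous_id).mul continuous_const)).measurableSet
  have hjacU : Measurable fun g : SU N => (jac c U g : ℝ≥0∞) :=
    ((hjacm c).comp (measurable_const.prodMk measurable_id)).coe_nnreal_ennreal
  -- `Haar⌊Ω ≪ (Haar⌊Ω)·jac`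
  have hac : (HaarData.haar : Measure (SU N)).restrict Ω ≪
      ((HaarData.haar : Measure (SU N)).restrict Ω).withDensity fun g => (jac c U g : ℝ≥0∞) := by
    refine withDensity_absolutelyContinuous' hjacU.aemeasurable ?_
    refine (ae_restrict_iff' hΩm).2 (Filter.Eventually.of_forall fun g hg => ?_)
    exact ENNReal.coe_ne_zero.2 (hjac0 c U g hg)
  have hup : (((HaarData.haar : Measure (SU N)).restrict Ω).withDensity fun g => (jac c U g : ℝ≥0∞)) (f ⁻¹' B) = 0 := by
    refine le_antisymm ?_ bot_le
    calc (((HaarData.haar : Measure (SU N)).restrict Ω).withDensity fun g => (jac c U g : ℝ≥0∞)) (f ⁻¹' B)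
        ≤ ((((HaarData.haar : Measure (SU N)).restrict Ω).withDensity fun g => (jac c U g : ℝ≥0∞)).map f) B :=
          Measure.le_map_apply hfm.aemeasurable _
      _ = ((HaarData.haar : Measure (SU N)).restrict (f '' Ω)) B := by rw [hlaw]
      _ ≤ (HaarData.haar : Measure (SU N)) B := Measure.le_iff'.1 Measure.restrict_le_self _
      _ = 0 := hB0
  have h := hac hup
  rwa [Measure.restrict_apply' hΩm, inter_comm] at h

end OneStep

end Summit.QuantumFields.YangMills.Theorems.FluctuationComparisonRegPrIntLWregChartEdgeEngine

end
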